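import Mathlib.Probability.Distributions.Gaussian.Multivariate
import Mathlib.Probability.Distributions.Gaussian.HasGaussianLaw.Basic
import Mathlib.Probability.Distributions.Gaussian.IsGaussianProcess.Basic
import Literature.Probability.Process.KolmogorovExtensionProofs
import Literature.Probability.Process.GaussianProcessLaw
import Literature.Probability.LatticeModels.LatticeGreenPoisson
import Literature.MathematicalPhysics.QuantumLattice.LatticeGaugeDLR
import HarnessLib

/-!
# The curvature (lattice Maxwell field-strength) Gaussian field on the plaquettes of `ℤ^d`

The definition `curvatureGaussianField d D : Measure (ZdPlaquette d → (Fin D → ℝ))` requested by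
route `QuantumFields/YangMills/EquipartitionCriticality` (item `EquipartitionPinsProbe`, child
`LocalFreeGluonLaw`: "the `β → ∞` local law of `√β`-rescaled plaquette variables of every
torus-limit lattice Yang–Mills state, in a rooted tree gauge per box, is
`curvatureGaussianField 4 (dim G)`"): the stationary centred Gaussian field `Y` of `ℝ^D`-valued
`2`-cochains on `ℤ^d` (`d ≥ 3`) with the covariance of `dA` for the massless lattice `1`-form `A`
with density `∝ exp(-½ ∑_p |dA_p|²)` per component — `D` independent copies of the lattice Maxwell
field strength — i.e. `E[Y_p^a Y_q^b] = δ_{ab} (d G d*)_{pq}` with `G = (-Δ)⁻¹` the massless Green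
kernel of `ℤ^d` acting diagonally on `1`-forms; together with the plaquette two-point numbers
`c_n = Cov(Y¹_{(0;1,2)}, Y¹_{(n e₀;1,2)})` and `c_0 = 2/d`. Everything in this file is proved; no
named fact is introduced.

## Contents

* A general construction (reusable): for a real kernel `K : ι → ι → ℝ`, the finite-dimensional
  centred Gaussian laws `gaussianFamilyOfKernel K I` (`I : Finset ι`; Mathlib
  `multivariateGaussian` with covariance matrix `covGram K I`, in the idiom of Mathlib's
  `BrownianReal.projectiveFamily`), their consistency for positive semidefinite kernels
  (`IsPosSemidefKernel`, `isProjectiveMeasureFamily_gaussianFamilyOfKernel`), and the Kolmogorov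
  extension `gaussianFieldOfKernel K : Measure (ι → ℝ)` (tree `Process.projectiveLimit`,
  `isProjectiveLimit_projectiveLimit_holds`), with: probability measure, centred
  (`integral_eval_gaussianFieldOfKernel`), Gaussian coordinate process
  (`isGaussianProcess_eval_gaussianFieldOfKernel`), covariance `= K`
  (`covariance_eval_gaussianFieldOfKernel`) and uniqueness given mean zero and covariance `K`
  (`eq_gaussianFieldOfKernel_of_isGaussianProcess`, via the tree's
  `IsGaussianProcess.map_eq_of_covariance_eq`). Kallenberg (2002), Lemma 13.1 / Thm 6.16.
* A positivity mechanism: kernels with an integral Gram representation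
  `Γ(e,f) = ∫ w ∑ₘ φₘ(e) φₘ(f)` are positive semidefinite along finite families
  (`sum_sum_mul_mul_nonneg_of_integral`), and so are their block-diagonal extensions
  (`sum_sum_mul_mul_ite_nonneg`).
* The lattice objects on the tree's `ℤ^d` bookkeeping (`ZdEdge`, `ZdPlaquette`, `plaquetteEdges` of
  `LatticeGaugeDLR`): `edgeGreen` (the Green function of `-Δ` on positively oriented edges,
  `[dir e = dir f] · G₀(x_e - x_f)`, `G₀ = latticeGreen/2`), `plaquetteBoundary`/`plaquetteBoundarySign`
  (the boundary `2`-chain `(x,i) + (x+eᵢ,j) - (x+eⱼ,i) - (x,j)` of `p = (x; i<j)`, the orientation of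
  `plaquetteHolonomyZd` and of `LatticeMaxwell.sCirc`; `image_plaquetteBoundary`), `plaquetteCurl`
  (`(dA)_p`), `curvatureTwoPoint p q = (d G d*)(p,q)`, `curvatureCovKernel d D` (`δ_{ab}` times it),
  **`curvatureGaussianField d D`** (the Gaussian field of that kernel, transported along currying),
  `plaquette12`, `curvaturePlaquetteCorr hd n = c_n`.
* Proved for `d ≥ 3`: `isPosSemidefKernel_curvatureCovKernel` (via the Fourier representation
  `G₀(x - y) = ∫_{[-π,π]^d} (2(2π)^d ε(k))⁻¹ (cos k·x cos k·y + sin k·x sin k·y) dk`,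
  `half_latticeGreen_sub_eq_integral`, and integrability of `1/ε` in `d ≥ 3`, tree
  `integrable_indicator_inv_dispersion`); hence `isProbabilityMeasure_curvatureGaussianField`,
  `integral_eval_curvatureGaussianField` (`E Y_p^a = 0`), `covariance_eval_curvatureGaussianField`
  (`Cov(Y_p^a, Y_q^b) = δ_{ab} curvatureTwoPoint p q`), `isGaussianProcess_eval_curvatureGaussianField`,
  `eq_curvatureGaussianField_of_isGaussianProcess` (uniqueness: a probability measure under which
  the plaquette variables are a Gaussian process with these means and covariances is this one),
  the lattice symmetries `latticeGreen_neg`, `latticeGreen_comp_equiv`, `latticeGreen_single`, the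
  increment `latticeGreen 0 - latticeGreen e₁ = 1/d` (`latticeGreen_zero_sub_latticeGreen_single`,
  from the tree's Poisson identity `latticeLaplacianZd_half_latticeGreen`), the plaquette variance
  **`curvatureTwoPoint_self : curvatureTwoPoint p p = 2/d`** (equipartition: `½ ∑_p E F_p² = (d-1)/2`
  per site), `variance_eval_curvatureGaussianField`, `curvaturePlaquetteCorr_zero : c_0 = 2/d`,
  `covariance_plaquette12_curvatureGaussianField` (`c_n` is the covariance it names), and
  stationarity/symmetry of the kernel (`curvatureTwoPoint_shift`, `curvatureTwoPoint_comm`).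

## What the sources print

* C. Garban, A. Sepúlveda, IMRN 2023 (arXiv:2107.04021) [GarbanSepulveda2023], read in the held
  text: §2.3.2, Definition (β-GFF on `1`-forms): "The `β`-GFF on `1`-forms is the real-valued
  centred Gaussian process `φ` … whose covariance matrix is given by `β⁻¹ (-Δ)⁻¹ = β⁻¹(dd* + d*d)⁻¹`"
  ("the discrete version of the so-called free electromagnetic wave (Gross 1983, Driver 1987)");
  §2.3.3, Definition (the gradient spin-wave on `2`-forms): "`ϱ` is a gradient spin-wave on
  `2`-forms at inverse temperature `β` if `ϱ =(law) dφ`, where `φ` is a GFF on `1`-forms at inverse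
  temperature `β`"; §3.3, Corollary/Definition (Green's function on the `1`-forms, `Λ = ℤⁿ`):
  "`(-Δ)⁻¹(e,e') = G_{𝒢ᵢ}(e,e')` if `e, e' ∈ 𝒢ᵢ`, `0` if `e ∈ 𝒢ᵢ, e' ∈ 𝒢ⱼ, i ≠ j`. Here `G_{𝒢ᵢ}` is
  the Green's function of the Laplacian in the graph `𝒢ᵢ ≈ ℤⁿ`"; §4, Proposition (law of the
  gradient spin-wave): "`(⟨ρ, f⟩)_{f ∈ Ω²}` is a centred Gaussian process with variance … 
  `E[⟨dφ, f⟩²] = E[⟨φ, d*f⟩²] = ⟨f, d d* Δ⁻¹ f⟩`". Taking `β = 1`, `Λ = ℤ^d` and `f` the indicators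
  of two plaquettes gives `E[(dφ)_p (dφ)_q] = ∑_{e ∈ ∂p, f ∈ ∂q} [p:e][q:f] (-Δ)⁻¹(e,f) = curvatureTwoPoint p q`.
* S. Chatterjee, JFA 271 (2016), arXiv:1602.01222 [arXiv160201222], §§13–14: the finite-volume,
  axial-gauge (comb-tree pinned) Gaussian lattice Maxwell measures `τ ∝ e^{-½ ∑_p s(p)²} ds` (tree
  `LatticeMaxwell.formM`, `LatticeMaxwell.τ`, `LatticeMaxwell.sCirc` for the curl `s(p)`).

## Design choices and flags

* The measure is built on the index set `ZdPlaquette d × Fin D` and transported along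
  `MeasurableEquiv.curry` to the requested type `ZdPlaquette d → (Fin D → ℝ)` (product σ-algebra of
  product σ-algebras). Colours are independent copies: `K((p,a),(q,b)) = [a = b] curvatureTwoPoint p q`.
* Normalisation `β = 1`: density `exp(-½ ∑_p (dA)_p²)`, `G₀ = (-Δ)⁻¹ = latticeGreen/2` with
  `(-Δ)f(x) = ∑ᵢ (2f(x) - f(x+eᵢ) - f(x-eᵢ))` (tree `latticeLaplacianZd`); plaquette variance `2/d`.
* `d ≥ 3`: `latticeGreen` is a Bochner integral of a non-integrable function for `d ≤ 2` (junk `0`),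
  so for `d ≤ 2` the kernel is `0` and nothing is claimed; every probabilistic statement carries
  `3 ≤ d`. (`curvatureTwoPoint` itself is the honest object whenever `G₀` is.)
* Gauge fixing: the informal density `exp(-½∑|dA|²) dA` is degenerate along gauge orbits; the law of
  `dA` is gauge independent and equals the law of `dφ` for the (Feynman-gauge) GFF `φ` on `1`-forms
  with covariance `(-Δ)⁻¹ = (dd* + d*d)⁻¹` — Garban–Sepúlveda's definition, which is the one
  transcribed. The identification with limits of Chatterjee's finite-volume axial-gauge measures
  `LatticeMaxwell.τ`, and the DLR characterisation "unique shift-invariant `L²` Gibbs measure with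
  zero tilt of the Gaussian closed-`2`-form specification" (Funaki–Spohn, CMP 185 (1997),
  doi:10.1007/s002200050231, one degree up) mentioned by the requesting planner, are NOT formalised
  here (the latter is not in print for `2`-forms).
* Stationarity is recorded at the level of the kernel (`curvatureTwoPoint_shift`); invariance of the
  measure under lattice shifts follows from uniqueness and is left to users.
* Orientation: `plaquetteBoundary p = ![(x,i), (x+eᵢ,j), (x+eⱼ,i), (x,j)]`, signs `![1, 1, -1, -1]`,
  matching `plaquetteHolonomyZd U x i j = U(x,i) U(x+eᵢ,j) U(x+eⱼ,i)⁻¹ U(x,j)⁻¹` and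
  `LatticeMaxwell.sCirc` (`LatticeMaxwellGaussian.lean`, not imported to keep the import cone of the
  requesting route small: this file adds only `KolmogorovExtensionProofs`, `GaussianProcessLaw`,
  `LatticeGreenPoisson` and Mathlib's Gaussian files to the cone of `LatticeGaugeDLR`).
* General lemmas about `latticeGreen` (`latticeGreen_neg`, `latticeGreen_comp_equiv`,
  `latticeGreen_single`, `latticeGreen_zero_sub_latticeGreen_single`,
  `setIntegral_brillouin_comp_equiv`) are declared in this file's path namespace (CONVENTIONS §2).

## Mathlib / tree anchors

Mathlib: `ProbabilityTheory.multivariateGaussian`, `covariance_eval_multivariateGaussian`,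
`measurePreserving_restrict₂_multivariateGaussian`, `IsProjectiveMeasureFamily`,
`IsProjectiveLimit`, `IsGaussianProcess`, `HasGaussianLaw`, `MeasurableEquiv.curry`,
`volume_measurePreserving_piCongrLeft`, `Matrix.PosSemidef.of_dotProduct_mulVec_nonneg`. Tree:
`Literature.Probability.Process.projectiveLimit` / `isProjectiveLimit_projectiveLimit_holds`
(Kolmogorov extension, proved), `IsGaussianProcess.map_eq_of_covariance_eq`,
`Literature.Probability.LatticeModels.latticeGreen`, `greenIntegrand`, `brillouin`, `dispersion`,
`integrable_indicator_inv_dispersion`, `latticeLaplacianZd_half_latticeGreen`,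
`Literature.MathematicalPhysics.QuantumLattice.ZdEdge` / `ZdPlaquette` / `plaquetteEdges`.
Mathlib has no lattice Gaussian free field / lattice gauge theory (searched `latticeGreen`,
`GaussianFreeField`, `plaquette`).

## References

* C. Garban, A. Sepúlveda, *Improved spin-wave estimate for Wilson loops in U(1) lattice gauge
  theory*, IMRN 2023 (21) 18142–18198, doi:10.1093/imrn/rnac356, arXiv:2107.04021, §§2.3.2–2.3.3,
  §3.3, §4. [GarbanSepulveda2023]
* S. Chatterjee, *The leading term of the Yang–Mills free energy*, JFA 271 (2016) 2944–3005,
  arXiv:1602.01222, §2, §§13–14. [arXiv160201222]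
* O. Kallenberg, *Foundations of Modern Probability* (2nd ed., 2002), Lemma 13.1, Thm 6.16.
  [Kallenberg2002]
* L. Gross, CMP 92 (1983) 137–162; B. Driver, CMP 110 (1987) 479–501 (free electromagnetic field as
  the continuum limit of `U(1)` lattice gauge theory); T. Funaki, H. Spohn, CMP 185 (1997) 1–36
  (gradient Gibbs measures) — context only.
-/

noncomputable section

universe u

open MeasureTheory ProbabilityTheory Finset WithLp
open scoped ENNReal NNReal Matrix

namespace Literature.MathematicalPhysics.QuantumFieldTheory

/-! ### Centred Gaussian fields on `ι → ℝ` with a prescribed covariance kernel -/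

section KernelGaussian

variable {ι : Type*}

/-- The Gram matrix `(K(s, t))_{s, t ∈ I}` of a real kernel `K` on a finite set of indices `I`.
[folklore] -/
def covGram (K : ι → ι → ℝ) (I : Finset ι) : Matrix I I ℝ :=
  Matrix.of fun s t : I => K s t

/-- `covGram K I s t = K s t`. [folklore] -/
@[simp]
theorem covGram_apply (K : ι → ι → ℝ) (I : Finset ι) (s t : I) : covGram K I s t = K s t := rfl

/-- Restricting the Gram matrix on `I` to `J ⊆ I` gives the Gram matrix on `J`. [folklore] -/
theorem covGram_submatrix (K : ι → ι → ℝ) {I J : Finset ι} (hJI : J ⊆ I) :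
    (covGram K I).submatrix (fun i : J => ⟨i.1, hJI i.2⟩) (fun i : J => ⟨i.1, hJI i.2⟩) =
      covGram K J := rfl

/-- A real kernel `K` on `ι` is **positive semidefinite** if all its finite Gram matrices are
positive semidefinite (in particular symmetric). [folklore] -/
def IsPosSemidefKernel (K : ι → ι → ℝ) : Prop :=
  ∀ I : Finset ι, (covGram K I).PosSemidef

variable [DecidableEq ι]

/-- The finite-dimensional laws of the centred Gaussian field with covariance kernel `K`: on the
coordinates `I`, the centred multivariate Gaussian with covariance matrix `covGram K I`,
transported from `EuclideanSpace ℝ I` to `I → ℝ` (the idiom of Mathlib's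
`ProbabilityTheory.BrownianReal.projectiveFamily`). Kallenberg, *Foundations of Modern
Probability* (2002), Lemma 13.1 / Thm 6.16. [folklore] -/
def gaussianFamilyOfKernel (K : ι → ι → ℝ) (I : Finset ι) : Measure (I → ℝ) :=
  (multivariateGaussian 0 (covGram K I)).map (MeasurableEquiv.toLp 2 (I → ℝ)).symm

/-- Up to the measurable equivalence `ofLp`, `gaussianFamilyOfKernel K I` is the centred
multivariate Gaussian with covariance matrix `covGram K I`. [folklore] -/
theorem measurePreserving_ofLp_gaussianFamilyOfKernel (K : ι → ι → ℝ) (I : Finset ι) :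
    MeasurePreserving ofLp (multivariateGaussian 0 (covGram K I)) (gaussianFamilyOfKernel K I) where
  measurable := by fun_prop
  map_eq := rfl

/-- Integration against `gaussianFamilyOfKernel K I` is integration against the multivariate
Gaussian. [folklore] -/
theorem integral_gaussianFamilyOfKernel {E : Type*} [NormedAddCommGroup E] [NormedSpace ℝ E]
    (K : ι → ι → ℝ) (I : Finset ι) (f : (I → ℝ) → E) :
    ∫ x, f x ∂gaussianFamilyOfKernel K I = ∫ x, f (ofLp x) ∂multivariateGaussian 0 (covGram K I) := by
  simp [gaussianFamilyOfKernel, integral_map_equiv]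

/-- The finite-dimensional laws are Gaussian measures. [folklore] -/
instance isGaussian_gaussianFamilyOfKernel (K : ι → ι → ℝ) (I : Finset ι) :
    IsGaussian (gaussianFamilyOfKernel K I) := by
  rw [gaussianFamilyOfKernel,
    show ⇑(MeasurableEquiv.toLp 2 (I → ℝ)).symm = ⇑(EuclideanSpace.equiv I ℝ) from rfl]
  infer_instance

/-- The finite-dimensional laws are probability measures. [folklore] -/
instance isProbabilityMeasure_gaussianFamilyOfKernel (K : ι → ι → ℝ) (I : Finset ι) :
    IsProbabilityMeasure (gaussianFamilyOfKernel K I) := inferInstance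

/-- The finite-dimensional laws are centred. [folklore] -/
@[simp]
theorem integral_id_gaussianFamilyOfKernel (K : ι → ι → ℝ) (I : Finset ι) :
    ∫ x, x ∂gaussianFamilyOfKernel K I = 0 := by
  rw [integral_gaussianFamilyOfKernel, ← PiLp.coe_continuousLinearEquiv 2 ℝ,
    ContinuousLinearEquiv.integral_comp_id_comm, integral_id_multivariateGaussian, map_zero]

/-- Each coordinate is centred under the finite-dimensional law. [folklore] -/
@[simp]
theorem integral_eval_gaussianFamilyOfKernel (K : ι → ι → ℝ) (I : Finset ι) (s : I) :
    ∫ x, x s ∂gaussianFamilyOfKernel K I = 0 := by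
  conv => enter [1, 2]; change fun x ↦ ContinuousLinearMap.proj (R := ℝ) s x
  rw [ContinuousLinearMap.integral_comp_id_comm, integral_id_gaussianFamilyOfKernel, map_zero]
  exact IsGaussian.integrable_id

/-- The covariance of two coordinates under the finite-dimensional law on `I` is the kernel
(positive semidefinite kernels). [folklore] -/
theorem covariance_eval_gaussianFamilyOfKernel {K : ι → ι → ℝ} (hK : IsPosSemidefKernel K)
    (I : Finset ι) (s t : I) :
    cov[fun x => x s, fun x => x t; gaussianFamilyOfKernel K I] = K s t := by
  rw [gaussianFamilyOfKernel, covariance_map_equiv]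
  exact covariance_eval_multivariateGaussian (hK I) s t

/-- **The finite-dimensional Gaussian laws of a positive semidefinite kernel form a projective
family** (Kolmogorov consistency): restricting the law on `I` to `J ⊆ I` gives the law on `J`,
because the restriction of a centred Gaussian vector is the centred Gaussian vector with the
restricted covariance matrix (Mathlib `measurePreserving_restrict₂_multivariateGaussian`).
Kallenberg, *Foundations* (2002), Lemma 13.1. [folklore] -/
theorem isProjectiveMeasureFamily_gaussianFamilyOfKernel {K : ι → ι → ℝ}
    (hK : IsPosSemidefKernel K) :
    IsProjectiveMeasureFamily (α := fun _ : ι => ℝ) (gaussianFamilyOfKernel K) := by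
  intro I J hJI
  nth_rw 2 [gaussianFamilyOfKernel]
  rw [Measure.map_map]
  · have : (Finset.restrict₂ (π := fun _ : ι => ℝ) hJI ∘ (MeasurableEquiv.toLp 2 (I → ℝ)).symm) =
        ofLp ∘ (EuclideanSpace.restrict₂ hJI) := by ext; simp
    rw [this, ((measurePreserving_ofLp_gaussianFamilyOfKernel K J).comp
        (measurePreserving_restrict₂_multivariateGaussian (hK I) hJI)).map_eq]
  · exact Finset.measurable_restrict₂ _
  · fun_prop

/-- **The centred Gaussian field on `ι → ℝ` with covariance kernel `K`**: the Kolmogorov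
extension (`Literature.Probability.Process.projectiveLimit`) of the projective family
`gaussianFamilyOfKernel K` of its finite-dimensional laws. For a positive semidefinite kernel this
is the unique probability measure on the product σ-algebra under which the coordinate process
`(ω ↦ ω s)_{s ∈ ι}` is a centred Gaussian process with `Cov(ω s, ω t) = K s t`
(`covariance_eval_gaussianFieldOfKernel`); for other `K` it is a junk value. Kallenberg,
*Foundations of Modern Probability* (2002), Lemma 13.1 with Thm 6.16. [folklore] -/
def gaussianFieldOfKernel (K : ι → ι → ℝ) : Measure (ι → ℝ) :=
  Literature.Probability.Process.projectiveLimit (α := fun _ : ι => ℝ) (gaussianFamilyOfKernel K)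

/-- The Gaussian field of a positive semidefinite kernel is the projective limit of its
finite-dimensional laws (the Kolmogorov extension theorem of the tree,
`Literature.Probability.Process.isProjectiveLimit_projectiveLimit_holds`; `ℝ` is Polish).
Kallenberg, *Foundations* (2002), Thm 6.16. [folklore] -/
theorem isProjectiveLimit_gaussianFieldOfKernel {K : ι → ι → ℝ} (hK : IsPosSemidefKernel K) :
    IsProjectiveLimit (α := fun _ : ι => ℝ) (gaussianFieldOfKernel K) (gaussianFamilyOfKernel K) :=
  Literature.Probability.Process.isProjectiveLimit_projectiveLimit_holds (α := fun _ : ι => ℝ)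
    (isProjectiveMeasureFamily_gaussianFamilyOfKernel hK)

/-- The Gaussian field of a positive semidefinite kernel is a probability measure. [folklore] -/
theorem isProbabilityMeasure_gaussianFieldOfKernel {K : ι → ι → ℝ} (hK : IsPosSemidefKernel K) :
    IsProbabilityMeasure (gaussianFieldOfKernel K) :=
  (isProjectiveLimit_gaussianFieldOfKernel hK).isProbabilityMeasure

/-- The finite-dimensional marginals of the Gaussian field are the Gaussian laws
`gaussianFamilyOfKernel K I`. [folklore] -/
theorem gaussianFieldOfKernel_map_restrict {K : ι → ι → ℝ} (hK : IsPosSemidefKernel K)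
    (I : Finset ι) :
    (gaussianFieldOfKernel K).map I.restrict = gaussianFamilyOfKernel K I :=
  isProjectiveLimit_gaussianFieldOfKernel hK I

/-- The coordinate process of the Gaussian field of a positive semidefinite kernel is a Gaussian
process. [folklore] -/
theorem isGaussianProcess_eval_gaussianFieldOfKernel {K : ι → ι → ℝ} (hK : IsPosSemidefKernel K) :
    IsGaussianProcess (fun (s : ι) (ω : ι → ℝ) => ω s) (gaussianFieldOfKernel K) := by
  refine ⟨fun I => ⟨?_⟩⟩
  rw [show (fun ω : ι → ℝ => I.restrict fun s => ω s) = I.restrict from rfl,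
    gaussianFieldOfKernel_map_restrict hK I]
  infer_instance

/-- The Gaussian field of a positive semidefinite kernel is centred: `∫ ω s dμ = 0`. [folklore] -/
theorem integral_eval_gaussianFieldOfKernel {K : ι → ι → ℝ} (hK : IsPosSemidefKernel K) (s : ι) :
    ∫ ω, ω s ∂gaussianFieldOfKernel K = 0 := by
  have hs : s ∈ ({s} : Finset ι) := Finset.mem_singleton_self s
  have h := integral_map (μ := gaussianFieldOfKernel K)
    (Finset.measurable_restrict ({s} : Finset ι)).aemeasurable
    (f := fun x : (({s} : Finset ι) : Type _) → ℝ => x ⟨s, hs⟩)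
    (measurable_pi_apply _).aestronglyMeasurable
  rw [gaussianFieldOfKernel_map_restrict hK, integral_eval_gaussianFamilyOfKernel] at h
  exact h.symm

/-- **The covariance of the Gaussian field of a positive semidefinite kernel is the kernel**:
`Cov(ω s, ω t) = K s t`. Kallenberg, *Foundations* (2002), Lemma 13.1. [folklore] -/
theorem covariance_eval_gaussianFieldOfKernel {K : ι → ι → ℝ} (hK : IsPosSemidefKernel K)
    (s t : ι) :
    cov[fun ω => ω s, fun ω => ω t; gaussianFieldOfKernel K] = K s t := by
  let I : Finset ι := {s, t}
  have hs : s ∈ I := by simp [I]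
  have ht : t ∈ I := by simp [I]
  have h := covariance_map (μ := gaussianFieldOfKernel K) (Z := I.restrict)
    (X := fun x : I → ℝ => x ⟨s, hs⟩) (Y := fun x : I → ℝ => x ⟨t, ht⟩)
    (measurable_pi_apply _).aestronglyMeasurable (measurable_pi_apply _).aestronglyMeasurable
    (Finset.measurable_restrict _).aemeasurable
  rw [gaussianFieldOfKernel_map_restrict hK I, covariance_eval_gaussianFamilyOfKernel hK I] at h
  exact h.symm

/-- **Uniqueness: a centred Gaussian law on `ι → ℝ` is determined by its covariance kernel.** If
under a probability measure `ν` on the product space the coordinate process is a Gaussian process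
with mean zero and covariance `K` (positive semidefinite), then `ν = gaussianFieldOfKernel K`.
Proof: on the product space `(ι → ℝ)² ` with `ν ⊗ μ`, the two coordinate processes are Gaussian
with the same mean and covariance functions, hence have the same law (tree
`IsGaussianProcess.map_eq_of_covariance_eq`, Kallenberg Lemma 13.1). [cite: Kallenberg2002, Lemma 13.1] -/
theorem eq_gaussianFieldOfKernel_of_isGaussianProcess {K : ι → ι → ℝ} (hK : IsPosSemidefKernel K)
    {ν : Measure (ι → ℝ)} [IsProbabilityMeasure ν]
    (hG : IsGaussianProcess (fun (s : ι) (ω : ι → ℝ) => ω s) ν) (hm : ∀ s, ∫ ω, ω s ∂ν = 0)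
    (hc : ∀ s t, cov[fun ω => ω s, fun ω => ω t; ν] = K s t) :
    ν = gaussianFieldOfKernel K := by
  haveI := isProbabilityMeasure_gaussianFieldOfKernel hK
  have hfst : (ν.prod (gaussianFieldOfKernel K)).map Prod.fst = ν := by
    rw [Measure.map_fst_prod, measure_univ, one_smul]
  have hsnd : (ν.prod (gaussianFieldOfKernel K)).map Prod.snd = gaussianFieldOfKernel K := by
    rw [Measure.map_snd_prod, measure_univ, one_smul]
  -- measurability of the finite-dimensional restrictions and of the coordinates
  have hres : ∀ I : Finset ι, Measurable fun ω : ι → ℝ => I.restrict fun s : ι => ω s :=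
    fun I => measurable_pi_lambda _ fun s => measurable_pi_apply _
  have hev : ∀ (s : ι) (ρ : Measure (ι → ℝ)), AEStronglyMeasurable (fun ω : ι → ℝ => ω s) ρ :=
    fun s ρ => (measurable_pi_apply s).aestronglyMeasurable
  -- the two coordinate processes on the product space
  have hX : IsGaussianProcess (fun (s : ι) (ω : (ι → ℝ) × (ι → ℝ)) => ω.1 s)
      (ν.prod (gaussianFieldOfKernel K)) := by
    refine ⟨fun I => ⟨?_⟩⟩
    have hcomp : (fun ω : (ι → ℝ) × (ι → ℝ) => I.restrict fun s => ω.1 s) =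
        (fun ω : ι → ℝ => I.restrict fun s : ι => ω s) ∘ Prod.fst := rfl
    rw [hcomp, ← Measure.map_map (hres I) measurable_fst, hfst]
    exact (hG.hasGaussianLaw I).isGaussian_map
  have hY : IsGaussianProcess (fun (s : ι) (ω : (ι → ℝ) × (ι → ℝ)) => ω.2 s)
      (ν.prod (gaussianFieldOfKernel K)) := by
    refine ⟨fun I => ⟨?_⟩⟩
    have hcomp : (fun ω : (ι → ℝ) × (ι → ℝ) => I.restrict fun s => ω.2 s) =
        (fun ω : ι → ℝ => I.restrict fun s : ι => ω s) ∘ Prod.snd := rfl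
    rw [hcomp, ← Measure.map_map (hres I) measurable_snd, hsnd]
    exact ((isGaussianProcess_eval_gaussianFieldOfKernel hK).hasGaussianLaw I).isGaussian_map
  have hint1 : ∀ s, ∫ ω : (ι → ℝ) × (ι → ℝ), ω.1 s ∂ν.prod (gaussianFieldOfKernel K) =
      ∫ ω, ω s ∂ν := by
    intro s
    have h := integral_map (μ := ν.prod (gaussianFieldOfKernel K)) (φ := Prod.fst)
      measurable_fst.aemeasurable (f := fun ω : ι → ℝ => ω s) (hev s _)
    rw [hfst] at h
    exact h.symm
  have hint2 : ∀ s, ∫ ω : (ι → ℝ) × (ι → ℝ), ω.2 s ∂ν.prod (gaussianFieldOfKernel K) =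
      ∫ ω, ω s ∂gaussianFieldOfKernel K := by
    intro s
    have h := integral_map (μ := ν.prod (gaussianFieldOfKernel K)) (φ := Prod.snd)
      measurable_snd.aemeasurable (f := fun ω : ι → ℝ => ω s) (hev s _)
    rw [hsnd] at h
    exact h.symm
  have hmXY : ∀ s, ∫ ω : (ι → ℝ) × (ι → ℝ), ω.1 s ∂ν.prod (gaussianFieldOfKernel K) =
      ∫ ω : (ι → ℝ) × (ι → ℝ), ω.2 s ∂ν.prod (gaussianFieldOfKernel K) := by
    intro s
    rw [hint1, hint2, hm, integral_eval_gaussianFieldOfKernel hK]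
  have hcov1 : ∀ s t, cov[fun ω : (ι → ℝ) × (ι → ℝ) => ω.1 s, fun ω => ω.1 t;
      ν.prod (gaussianFieldOfKernel K)] = cov[fun ω => ω s, fun ω => ω t; ν] := by
    intro s t
    have h := covariance_map (μ := ν.prod (gaussianFieldOfKernel K)) (Z := Prod.fst)
      (X := fun ω : ι → ℝ => ω s) (Y := fun ω : ι → ℝ => ω t) (hev s _) (hev t _)
      measurable_fst.aemeasurable
    rw [hfst] at h
    exact h.symm
  have hcov2 : ∀ s t, cov[fun ω : (ι → ℝ) × (ι → ℝ) => ω.2 s, fun ω => ω.2 t;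
      ν.prod (gaussianFieldOfKernel K)] = cov[fun ω => ω s, fun ω => ω t; gaussianFieldOfKernel K] := by
    intro s t
    have h := covariance_map (μ := ν.prod (gaussianFieldOfKernel K)) (Z := Prod.snd)
      (X := fun ω : ι → ℝ => ω s) (Y := fun ω : ι → ℝ => ω t) (hev s _) (hev t _)
      measurable_snd.aemeasurable
    rw [hsnd] at h
    exact h.symm
  have hcXY : ∀ s t, cov[fun ω : (ι → ℝ) × (ι → ℝ) => ω.1 s, fun ω => ω.1 t;
      ν.prod (gaussianFieldOfKernel K)] =
      cov[fun ω : (ι → ℝ) × (ι → ℝ) => ω.2 s, fun ω => ω.2 t; ν.prod (gaussianFieldOfKernel K)] := by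
    intro s t
    rw [hcov1, hcov2, hc, covariance_eval_gaussianFieldOfKernel hK]
  have key := hX.map_eq_of_covariance_eq hY hmXY hcXY measurable_fst.aemeasurable
    measurable_snd.aemeasurable
  calc ν = (ν.prod (gaussianFieldOfKernel K)).map Prod.fst := hfst.symm
    _ = (ν.prod (gaussianFieldOfKernel K)).map Prod.snd := key
    _ = gaussianFieldOfKernel K := hsnd

end KernelGaussian

/-! ### Positive semidefiniteness of kernels with an integral Gram representation -/

section IntegralGram

variable {X : Type*} [MeasurableSpace X] {E M : Type*} [Fintype M]

/-- **Kernels with an integral Gram representation are positive semidefinite along families.**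
If `Γ(e, f) = ∫ w(k) ∑ₘ φₘ(e, k) φₘ(f, k) dμ(k)` with a weight `w ≥ 0` (a.e.) and integrable
summands, then `∑ⱼ ∑ⱼ' cⱼ cⱼ' Γ(g j, g j') = ∫ w ∑ₘ (∑ⱼ cⱼ φₘ(g j, ·))² dμ ≥ 0` for every finite
family `g : J → E` (repetitions allowed) and real coefficients `c`. This is the mechanism of
Bochner's theorem in the easy direction. [folklore] -/
theorem sum_sum_mul_mul_nonneg_of_integral (μ : Measure X) (w : X → ℝ) (hw : 0 ≤ᵐ[μ] w)
    (φ : M → E → X → ℝ) (Γ : E → E → ℝ)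
    (hint : ∀ m e f, Integrable (fun k => w k * (φ m e k * φ m f k)) μ)
    (hΓ : ∀ e f, Γ e f = ∫ k, w k * ∑ m, φ m e k * φ m f k ∂μ)
    {J : Type*} [Fintype J] (g : J → E) (c : J → ℝ) :
    0 ≤ ∑ j, ∑ j', c j * c j' * Γ (g j) (g j') := by
  have hI : ∀ j j', Integrable (fun k => c j * c j' * (w k * ∑ m, φ m (g j) k * φ m (g j') k)) μ := by
    intro j j'
    refine Integrable.const_mul ?_ _
    have : (fun k => w k * ∑ m, φ m (g j) k * φ m (g j') k) =
        fun k => ∑ m, w k * (φ m (g j) k * φ m (g j') k) := funext fun k => by rw [Finset.mul_sum]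
    rw [this]
    exact integrable_finsetSum _ fun m _ => hint m (g j) (g j')
  have key : ∑ j, ∑ j', c j * c j' * Γ (g j) (g j') =
      ∫ k, w k * ∑ m, (∑ j, c j * φ m (g j) k) ^ 2 ∂μ := by
    calc ∑ j, ∑ j', c j * c j' * Γ (g j) (g j')
        = ∑ j, ∑ j', ∫ k, c j * c j' * (w k * ∑ m, φ m (g j) k * φ m (g j') k) ∂μ := by
          refine Finset.sum_congr rfl fun j _ => Finset.sum_congr rfl fun j' _ => ?_
          rw [hΓ, integral_const_mul]
      _ = ∫ k, ∑ j, ∑ j', c j * c j' * (w k * ∑ m, φ m (g j) k * φ m (g j') k) ∂μ := by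
          rw [integral_finsetSum _ fun j _ => integrable_finsetSum _ fun j' _ => hI j j']
          exact Finset.sum_congr rfl fun j _ => (integral_finsetSum _ fun j' _ => hI j j').symm
      _ = ∫ k, w k * ∑ m, (∑ j, c j * φ m (g j) k) ^ 2 ∂μ := by
          refine integral_congr_ae (ae_of_all _ fun k => ?_)
          symm
          calc w k * ∑ m, (∑ j, c j * φ m (g j) k) ^ 2
              = w k * ∑ m, ∑ j, ∑ j', c j * φ m (g j) k * (c j' * φ m (g j') k) := by
                congr 1
                refine Finset.sum_congr rfl fun m _ => ?_
                rw [sq, Finset.sum_mul_sum]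
            _ = ∑ j, ∑ j', w k * ∑ m, c j * φ m (g j) k * (c j' * φ m (g j') k) := by
                rw [Finset.sum_comm, Finset.mul_sum]
                refine Finset.sum_congr rfl fun j _ => ?_
                rw [Finset.sum_comm, Finset.mul_sum]
            _ = ∑ j, ∑ j', c j * c j' * (w k * ∑ m, φ m (g j) k * φ m (g j') k) := by
                refine Finset.sum_congr rfl fun j _ => Finset.sum_congr rfl fun j' _ => ?_
                simp only [Finset.mul_sum]
                refine Finset.sum_congr rfl fun m _ => ?_
                ring
  rw [key]
  exact integral_nonneg_of_ae (hw.mono fun k hk =>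
    mul_nonneg hk (Finset.sum_nonneg fun m _ => sq_nonneg _))

end IntegralGram

/-! ### The lattice objects: edges, plaquette boundaries, the edge Green kernel -/

section Lattice

open Literature.Probability.LatticeModels Literature.MathematicalPhysics.QuantumLattice

variable {d : ℕ}

/-- **The Green function of `-Δ` on the positively oriented edges (`1`-forms) of `ℤ^d`**
(Garban–Sepúlveda 2023, §3.3, Definition "Green's function on the 1-forms" of `Λ = ℤ^n`:
"`(-Δ)⁻¹(e, e') = G_{𝒢ᵢ}(e, e')` if `e, e' ∈ 𝒢ᵢ` [both in direction `i`], `0` if `e ∈ 𝒢ᵢ`,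
`e' ∈ 𝒢ⱼ`, `i ≠ j`; here `G_{𝒢ᵢ}` is the Green's function of the Laplacian in the graph
`𝒢ᵢ ≈ ℤ^n`"): for `e = (x, i)`, `f = (y, j)`,
`edgeGreen e f = [i = j] · G₀(x - y)` with `G₀ = latticeGreen / 2` the Green function of the graph
Laplacian of `ℤ^d` (`(-Δ) G₀ = δ₀` for `d ≥ 3`, tree
`Literature.Probability.LatticeModels.latticeLaplacianZd_half_latticeGreen`; for `d ≤ 2`, `G₀` is
the junk value `0`). It is the covariance of the massless Gaussian free field on `1`-forms
`φ ∝ exp(-½⟨φ, (-Δ)φ⟩) dφ`, `-Δ = dd* + d*d` the Hodge Laplacian (Garban–Sepúlveda 2023 §2.3.2,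
Definition "β-GFF on 1-forms", at `β = 1`; Gross 1983 / Driver 1987 "free electromagnetic
wave"). [cite: GarbanSepulveda2023, §3.3 Definition (Green's function on the 1-forms, Λ = ℤⁿ) and §2.3.2 Definition (β-GFF on 1-forms); arXiv:2107.04021] -/
def edgeGreen (e f : ZdEdge d) : ℝ :=
  if e.2 = f.2 then latticeGreen (e.1 - f.1) / 2 else 0

/-- Unfolding lemma for `edgeGreen`. [folklore] -/
theorem edgeGreen_apply (e f : ZdEdge d) :
    edgeGreen e f = if e.2 = f.2 then latticeGreen (e.1 - f.1) / 2 else 0 := rfl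

/-- **The four boundary edges of the plaquette `p = (x; i < j)`**, in the order
`(x, i), (x + eᵢ, j), (x + eⱼ, i), (x, j)` of the plaquette holonomy
`U(x,i) U(x+eᵢ,j) U(x+eⱼ,i)⁻¹ U(x,j)⁻¹` (`Literature.MathematicalPhysics.QuantumLattice.plaquetteHolonomyZd`,
`plaquetteEdges`; Chatterjee arXiv:1803.01950 §2). [folklore] -/
def plaquetteBoundary (p : ZdPlaquette d) : Fin 4 → ZdEdge d :=
  ![(p.1, p.2.1.1), (p.1 + Pi.single p.2.1.1 1, p.2.1.2), (p.1 + Pi.single p.2.1.2 1, p.2.1.1),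
    (p.1, p.2.1.2)]

/-- **The orientation signs `+1, +1, -1, -1`** of the four boundary edges of a plaquette (the
boundary `2`-chain `∂p = (x,i) + (x+eᵢ,j) - (x+eⱼ,i) - (x,j)`, i.e. the incidence numbers of the
lattice exterior derivative `d` from `1`-cochains to `2`-cochains:
`(dA)_p = A(x,i) + A(x+eᵢ,j) - A(x+eⱼ,i) - A(x,j)`, Chatterjee arXiv:1602.01222 §2, the tree's
`LatticeMaxwell.sCirc`). [folklore] -/
def plaquetteBoundarySign : Fin 4 → ℝ := ![1, 1, -1, -1]

/-- The boundary edges of `p` are exactly the tree's `plaquetteEdges p`. [folklore] -/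
theorem image_plaquetteBoundary (p : ZdPlaquette d) :
    Finset.univ.image (plaquetteBoundary p) = plaquetteEdges p := by
  ext e
  simp only [Finset.mem_image, Finset.mem_univ, true_and, plaquetteEdges, Finset.mem_insert,
    Finset.mem_singleton, plaquetteBoundary]
  constructor
  · rintro ⟨a, rfl⟩
    fin_cases a <;> simp
  · rintro (rfl | rfl | rfl | rfl)
    · exact ⟨0, rfl⟩
    · exact ⟨1, rfl⟩
    · exact ⟨2, rfl⟩
    · exact ⟨3, rfl⟩

/-- **The lattice exterior derivative (curl) of a `1`-cochain at a plaquette**: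
`(dA)_p = ∑ₐ σₐ A(∂ₐ p) = A(x,i) + A(x+eᵢ,j) - A(x+eⱼ,i) - A(x,j)` for `p = (x; i < j)`
(Chatterjee, JFA 271 (2016), arXiv:1602.01222, §2, "`t(x,j,k)`"; Garban–Sepúlveda 2023 §2.2,
`dθ`). On genuine plaquettes this is the tree's `LatticeMaxwell.sCirc` (there on the larger type
`Plaq d`, not imported here). [cite: arXiv160201222, §2] -/
def plaquetteCurl (A : ZdEdge d → ℝ) (p : ZdPlaquette d) : ℝ :=
  ∑ a : Fin 4, plaquetteBoundarySign a * A (plaquetteBoundary p a)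

/-- `plaquetteCurl` written out. [folklore] -/
theorem plaquetteCurl_eq (A : ZdEdge d → ℝ) (p : ZdPlaquette d) :
    plaquetteCurl A p = A (p.1, p.2.1.1) + A (p.1 + Pi.single p.2.1.1 1, p.2.1.2) -
      A (p.1 + Pi.single p.2.1.2 1, p.2.1.1) - A (p.1, p.2.1.2) := by
  simp only [plaquetteCurl, plaquetteBoundary, plaquetteBoundarySign, Fin.sum_univ_four,
    Matrix.cons_val_zero, Matrix.cons_val_one, Matrix.cons_val]
  ring

/-- **The two-plaquette kernel of the lattice Maxwell field strength (curvature)**: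
`curvatureTwoPoint p q = (d (-Δ)⁻¹ d*)(p, q) = ∑_{a,b} σₐ σ_b (-Δ)⁻¹(∂ₐ p, ∂_b q)`, the covariance
`E[(dφ)_p (dφ)_q]` of the exterior derivative `dφ` of the massless Gaussian free field `φ` on
`1`-forms of `ℤ^d` with covariance `(-Δ)⁻¹ = edgeGreen` — Garban–Sepúlveda's *gradient spin-wave
on `2`-forms* at `β = 1` (§2.3.3, Definition: "`ϱ` is a gradient spin-wave on `2`-forms at inverse
temperature `β` if `ϱ =(law) dφ`, where `φ` is a GFF on `1`-forms at inverse temperature `β`";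
§4, Proposition: "`(⟨ρ, f⟩)_{f ∈ Ω²}` is a centred Gaussian process with variance
`E[⟨dφ, f⟩²] = E[⟨φ, d*f⟩²] = … = ⟨f, d d* Δ⁻¹ f⟩`"), evaluated on the indicator `2`-forms of two
plaquettes. Well defined (non-junk) for `d ≥ 3`. It is also the `β → ∞` (Gaussian) two-plaquette
function of the field strength of compact/Villain `U(1)` lattice gauge theory and the
infinite-volume kernel behind Chatterjee's finite-volume lattice Maxwell measures
(arXiv:1602.01222 §§13–14, tree `LatticeMaxwell.τ`). [cite: GarbanSepulveda2023, §2.3.3 Definition (gradient spin-wave on 2-forms) and §4 Proposition (law of the gradient spin-wave); arXiv:2107.04021] -/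
def curvatureTwoPoint (p q : ZdPlaquette d) : ℝ :=
  ∑ a : Fin 4, ∑ b : Fin 4, plaquetteBoundarySign a * plaquetteBoundarySign b *
    edgeGreen (plaquetteBoundary p a) (plaquetteBoundary q b)

/-- `curvatureTwoPoint p q` is the curl in `p` of the curl in `q` of the edge Green kernel:
`(d Γ d*)(p, q) = d_p (e ↦ d_q (f ↦ Γ(e, f)))`. [folklore] -/
theorem curvatureTwoPoint_eq_plaquetteCurl (p q : ZdPlaquette d) :
    curvatureTwoPoint p q = plaquetteCurl (fun e => plaquetteCurl (fun f => edgeGreen e f) q) p := by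
  simp only [curvatureTwoPoint, plaquetteCurl, Finset.mul_sum]
  refine Finset.sum_congr rfl fun a _ => Finset.sum_congr rfl fun b _ => ?_
  ring

/-- Translating both plaquettes by the same vector does not change the two-plaquette kernel
(stationarity). [folklore] -/
theorem curvatureTwoPoint_shift (p q : ZdPlaquette d) (v : Literature.Probability.LatticeModels.Site d) :
    curvatureTwoPoint (p.1 + v, p.2) (q.1 + v, q.2) = curvatureTwoPoint p q := by
  simp only [curvatureTwoPoint]
  refine Finset.sum_congr rfl fun a _ => Finset.sum_congr rfl fun b _ => ?_
  congr 1
  fin_cases a <;> fin_cases b <;>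
    simp [plaquetteBoundary, edgeGreen, add_right_comm _ v, add_sub_add_right_eq_sub]

variable (d) in
/-- **The covariance kernel of the `ℝ^D`-valued curvature Gaussian field**: on the index set
`ZdPlaquette d × Fin D` (plaquette, colour), `K((p, a), (q, b)) = [a = b] · curvatureTwoPoint p q`
— `D` independent identically distributed copies of the lattice Maxwell field strength (one per
Lie-algebra direction in the intended use: the `β → ∞` local law of `√β`-rescaled plaquette
variables of lattice Yang–Mills with `D = dim G`). [folklore] -/
def curvatureCovKernel (D : ℕ) (s t : ZdPlaquette d × Fin D) : ℝ :=
  if s.2 = t.2 then curvatureTwoPoint s.1 t.1 else 0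

/-- Unfolding lemma for `curvatureCovKernel`. [folklore] -/
theorem curvatureCovKernel_apply (D : ℕ) (p q : ZdPlaquette d) (a b : Fin D) :
    curvatureCovKernel d D (p, a) (q, b) = if a = b then curvatureTwoPoint p q else 0 := rfl

variable (d) in
/-- **The curvature Gaussian field** `curvatureGaussianField d D`: the centred Gaussian
probability measure on `ℝ^D`-valued `2`-cochains `Y : ZdPlaquette d → (Fin D → ℝ)` of `ℤ^d` with
covariance `E[Y_p^a Y_q^b] = δ_{ab} · (d (-Δ)⁻¹ d*)(p, q)` (`curvatureCovKernel`,
`covariance_eval_curvatureGaussianField`), i.e. `D` i.i.d. copies of the law of the field strength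
`dA` of the massless lattice `1`-form `A` with density `∝ exp(-½ ∑_p (dA)_p²)` (gauge-fixed; the
law of `dA` does not depend on the gauge) — Garban–Sepúlveda's gradient spin-wave on `2`-forms of
`ℤ^d` at `β = 1` (IMRN 2023, §2.3.3 and §4; the infinite-volume, `ℝ^D`-valued version), the
`β → ∞` limit object of the `√β`-rescaled plaquette variables of lattice gauge theory
(Chatterjee arXiv:1602.01222 §§13–14 for the finite-volume axial-gauge Gaussian, tree
`LatticeMaxwell.τ`). Construction: Kolmogorov extension of the consistent centred Gaussian laws
with covariance `curvatureCovKernel d D` on finite sets of (plaquette, colour) indices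
(`gaussianFieldOfKernel`), transported along currying
`(ZdPlaquette d × Fin D → ℝ) ≃ᵐ (ZdPlaquette d → Fin D → ℝ)`. Meaningful for `d ≥ 3`, where the
kernel is positive semidefinite (`isPosSemidefKernel_curvatureCovKernel`) and the measure is the
unique centred Gaussian probability measure with the stated (shift-invariant) covariance, of
plaquette variance `E[(Y_p^a)²] = 2/d` (`curvatureTwoPoint_self`,
`eq_curvatureGaussianField_of_isGaussianProcess`); for `d ≤ 2` the Green function is a junk value.
[cite: GarbanSepulveda2023, §2.3.3 Definition (gradient spin-wave on 2-forms), §4 Proposition (its law), §3.3 Definition (Green's function on 1-forms of ℤⁿ); arXiv:2107.04021] -/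
def curvatureGaussianField (D : ℕ) : Measure (ZdPlaquette d → (Fin D → ℝ)) :=
  (gaussianFieldOfKernel (curvatureCovKernel d D)).map (MeasurableEquiv.curry (ZdPlaquette d) (Fin D) ℝ)

/-- The plaquette at `x` in the `(1, 2)` coordinate plane of `ℤ^d`, `d ≥ 3`. [folklore] -/
def plaquette12 (hd : 3 ≤ d) (x : Literature.Probability.LatticeModels.Site d) : ZdPlaquette d :=
  (x, ⟨(⟨1, by omega⟩, ⟨2, by omega⟩), Fin.mk_lt_mk.2 one_lt_two⟩)

/-- **The plaquette two-point numbers along the `e₀` axis**: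
`c_n = Cov(Y¹_{(0; 1, 2)}, Y¹_{(n e₀; 1, 2)}) = curvatureTwoPoint (0; 1, 2) (n e₀; 1, 2)`, the
lattice Maxwell field-strength correlation between the plaquette at the origin in the `(1, 2)` plane
and its translate by `n e₀` (`d ≥ 3`; `c_0 = 2/d`, `curvaturePlaquetteCorr_zero`). [folklore] -/
def curvaturePlaquetteCorr (hd : 3 ≤ d) (n : ℤ) : ℝ :=
  curvatureTwoPoint (plaquette12 hd 0) (plaquette12 hd (Pi.single ⟨0, by omega⟩ n))

end Lattice

/-! ### Positive semidefiniteness of the curvature kernel (`d ≥ 3`) via the Fourier representation -/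

section PosSemidef

open Literature.Probability.LatticeModels Literature.MathematicalPhysics.QuantumLattice Real

variable {d : ℕ}

/-- **Block-diagonal extension of a positive semidefinite kernel**: if `Γ₀` is positive
semidefinite along families, so is `((x, λ), (y, λ')) ↦ [λ = λ'] Γ₀(x, y)`:
`∑ⱼⱼ' cⱼ cⱼ' [λⱼ = λⱼ'] Γ₀(gⱼ, gⱼ') = ∑_l ∑ⱼⱼ' (cⱼ[λⱼ = l]) (cⱼ'[λⱼ' = l]) Γ₀(gⱼ, gⱼ') ≥ 0`.
[folklore] -/
theorem sum_sum_mul_mul_ite_nonneg {E Λ : Type*} [Fintype Λ] [DecidableEq Λ] (Γ₀ : E → E → ℝ)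
    (h : ∀ (J : Type u) [Fintype J] (g : J → E) (c : J → ℝ),
      0 ≤ ∑ j, ∑ j', c j * c j' * Γ₀ (g j) (g j'))
    {J : Type u} [Fintype J] (g : J → E) (lam : J → Λ) (c : J → ℝ) :
    0 ≤ ∑ j, ∑ j', c j * c j' * (if lam j = lam j' then Γ₀ (g j) (g j') else 0) := by
  have key : ∑ l, ∑ j, ∑ j', (if lam j = l then c j else 0) * (if lam j' = l then c j' else 0) *
        Γ₀ (g j) (g j') =
      ∑ j, ∑ j', c j * c j' * (if lam j = lam j' then Γ₀ (g j) (g j') else 0) := by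
    calc ∑ l, ∑ j, ∑ j', (if lam j = l then c j else 0) * (if lam j' = l then c j' else 0) *
          Γ₀ (g j) (g j')
        = ∑ j, ∑ l, ∑ j', (if lam j = l then c j else 0) * (if lam j' = l then c j' else 0) *
          Γ₀ (g j) (g j') := Finset.sum_comm
      _ = ∑ j, ∑ j', ∑ l, (if lam j = l then c j else 0) * (if lam j' = l then c j' else 0) *
          Γ₀ (g j) (g j') := Finset.sum_congr rfl fun j _ => Finset.sum_comm
      _ = ∑ j, ∑ j', c j * c j' * (if lam j = lam j' then Γ₀ (g j) (g j') else 0) := by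
          refine Finset.sum_congr rfl fun j _ => Finset.sum_congr rfl fun j' _ => ?_
          rw [Finset.sum_eq_single (lam j)]
          · by_cases hjj : lam j = lam j'
            · simp [hjj]
            · simp [hjj, Ne.symm hjj]
          · intro l _ hl
            simp [Ne.symm hl]
          · simp
  rw [← key]
  exact Finset.sum_nonneg fun l _ => h J g _

/-- `p·(x - y) = p·x - p·y` for the phase `p·z = ∑ᵢ pᵢ zᵢ`, `z ∈ ℤ^d`. [folklore] -/
theorem sum_mul_intCast_sub (p : Fin d → ℝ) (x y : Literature.Probability.LatticeModels.Site d) :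
    ∑ i, p i * ((x - y) i : ℝ) = ∑ i, p i * (x i : ℝ) - ∑ i, p i * (y i : ℝ) := by
  simp only [Pi.sub_apply, Int.cast_sub, mul_sub, Finset.sum_sub_distrib]

/-- The Fourier modes `cos (k·x)` (`true`) and `sin (k·x)` (`false`) of `ℤ^d`. [folklore] -/
def siteFourierMode (b : Bool) (x : Literature.Probability.LatticeModels.Site d) (k : Fin d → ℝ) : ℝ :=
  bif b then Real.cos (∑ i, k i * (x i : ℝ)) else Real.sin (∑ i, k i * (x i : ℝ))

/-- `∑_b φ_b(x, k) φ_b(y, k) = cos (k·x) cos (k·y) + sin (k·x) sin (k·y) = cos (k·(x - y))`.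
[folklore] -/
theorem sum_siteFourierMode_mul (x y : Literature.Probability.LatticeModels.Site d) (k : Fin d → ℝ) :
    ∑ b, siteFourierMode b x k * siteFourierMode b y k = Real.cos (∑ i, k i * ((x - y) i : ℝ)) := by
  rw [Fintype.sum_bool, sum_mul_intCast_sub, Real.cos_sub]
  simp [siteFourierMode]

/-- The Fourier modes are measurable in the momentum. [folklore] -/
@[fun_prop]
theorem measurable_siteFourierMode (b : Bool) (x : Literature.Probability.LatticeModels.Site d) :
    Measurable (siteFourierMode b x) := by
  have hc : Measurable fun k : Fin d → ℝ => Real.cos (∑ i, k i * (x i : ℝ)) := by fun_prop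
  have hs : Measurable fun k : Fin d → ℝ => Real.sin (∑ i, k i * (x i : ℝ)) := by fun_prop
  cases b
  · exact hs
  · exact hc

/-- `|φ_b(x, k)| ≤ 1`. [folklore] -/
theorem abs_siteFourierMode_le_one (b : Bool) (x : Literature.Probability.LatticeModels.Site d)
    (k : Fin d → ℝ) : |siteFourierMode b x k| ≤ 1 := by
  cases b
  · exact Real.abs_sin_le_one _
  · exact Real.abs_cos_le_one _

variable (d) in
/-- The Fourier weight `w(k) = (2 (2π)^d ε(k))⁻¹` of the Green function `G₀ = latticeGreen / 2`
of `-Δ` (`ε(k) = ∑ᵢ (1 - cos kᵢ)` is half the symbol of `-Δ`). [folklore] -/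
def greenFourierWeight (k : Fin d → ℝ) : ℝ :=
  (2 * (2 * π) ^ d * dispersion k)⁻¹

/-- `w ≥ 0`. [folklore] -/
theorem greenFourierWeight_nonneg (k : Fin d → ℝ) : 0 ≤ greenFourierWeight d k := by
  unfold greenFourierWeight
  have := dispersion_nonneg k
  positivity

/-- `w(k) cos (k·z) = (2 (2π)^d)⁻¹ · h_z(k)` with `h_z = cos (k·z)/ε(k)` the tree's `greenIntegrand`.
[folklore] -/
theorem greenFourierWeight_mul_cos (k : Fin d → ℝ) (z : Literature.Probability.LatticeModels.Site d) :
    greenFourierWeight d k * Real.cos (∑ i, k i * (z i : ℝ)) =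
      (2 * (2 * π) ^ d)⁻¹ * greenIntegrand z k := by
  rw [greenFourierWeight, greenIntegrand]
  ring

/-- Integrability of `w(k) φ_b(x, k) φ_b'(y, k)` on the Brillouin zone for `d ≥ 3` (the weight is
`O(‖k‖⁻²)`, integrable in dimension `≥ 3`: tree `integrable_indicator_inv_dispersion`; the modes
are bounded by `1`). [folklore] -/
theorem integrable_greenFourierWeight_mul (hd : 3 ≤ d) (b : Bool)
    (x y : Literature.Probability.LatticeModels.Site d) :
    Integrable (fun k => greenFourierWeight d k * (siteFourierMode b x k * siteFourierMode b y k))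
      ((volume : Measure (Fin d → ℝ)).restrict (brillouin d)) := by
  have hw : Integrable (greenFourierWeight d) ((volume : Measure (Fin d → ℝ)).restrict (brillouin d)) := by
    have h1 : IntegrableOn (fun p : Fin d → ℝ => 1 / dispersion p) (brillouin d) volume :=
      (integrable_indicator_iff (measurableSet_brillouin d)).1
        (integrable_indicator_inv_dispersion d hd)
    have h2 := h1.const_mul (2 * (2 * π) ^ d)⁻¹
    refine h2.congr (ae_of_all _ fun k => ?_)
    simp only [greenFourierWeight, one_div, mul_inv]
  refine hw.mul_bdd (c := 1)
    ((measurable_siteFourierMode b x).mul (measurable_siteFourierMode b y)).aestronglyMeasurable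
    (ae_of_all _ fun k => ?_)
  rw [Real.norm_eq_abs, abs_mul]
  exact mul_le_one₀ (abs_siteFourierMode_le_one b x k) (abs_nonneg _) (abs_siteFourierMode_le_one b y k)

/-- **Fourier representation of the Green function of `-Δ`**:
`G₀(x - y) = latticeGreen (x - y) / 2 = ∫_{[-π,π]^d} w(k) (cos k·x cos k·y + sin k·x sin k·y) dk`
(an identity of Bochner integrals, valid also in the junk range `d ≤ 2`). [folklore] -/
theorem half_latticeGreen_sub_eq_integral (x y : Literature.Probability.LatticeModels.Site d) :
    latticeGreen (x - y) / 2 =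
      ∫ k in brillouin d, greenFourierWeight d k * ∑ b, siteFourierMode b x k * siteFourierMode b y k := by
  simp_rw [sum_siteFourierMode_mul, greenFourierWeight_mul_cos]
  rw [integral_const_mul, latticeGreen_eq]
  have hπ : (2 * π) ^ d ≠ 0 := by positivity
  field_simp

/-- **The Green function of `-Δ` on `ℤ^d` (`d ≥ 3`) is a positive semidefinite kernel** (along
arbitrary finite families of sites): `∑ⱼⱼ' cⱼ cⱼ' G₀(xⱼ - xⱼ') = ∫ w |∑ⱼ cⱼ e^{ik·xⱼ}|² dk ≥ 0`.
[folklore] -/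
theorem sum_sum_mul_mul_half_latticeGreen_nonneg (hd : 3 ≤ d) (J : Type u) [Fintype J]
    (g : J → Literature.Probability.LatticeModels.Site d) (c : J → ℝ) :
    0 ≤ ∑ j, ∑ j', c j * c j' * (latticeGreen (g j - g j') / 2) :=
  sum_sum_mul_mul_nonneg_of_integral ((volume : Measure (Fin d → ℝ)).restrict (brillouin d))
    (greenFourierWeight d) (ae_of_all _ greenFourierWeight_nonneg) (fun b x k => siteFourierMode b x k)
    (fun x y => latticeGreen (x - y) / 2)
    (fun b x y => integrable_greenFourierWeight_mul hd b x y)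
    (fun x y => half_latticeGreen_sub_eq_integral x y) g c

/-- **The covariance kernel of `D` independent copies of the massless Gaussian free field on
`1`-forms**: `((e, a), (f, b)) ↦ [a = b] · edgeGreen e f = [dir e = dir f] [a = b] G₀(x_e - x_f)`.
[folklore] -/
def edgeCovKernel (D : ℕ) (s t : ZdEdge d × Fin D) : ℝ :=
  if s.2 = t.2 then edgeGreen s.1 t.1 else 0

/-- `edgeCovKernel` as a block-diagonal extension of `G₀` over the label `(direction, colour)`.
[folklore] -/
theorem edgeCovKernel_eq_ite (D : ℕ) (s t : ZdEdge d × Fin D) :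
    edgeCovKernel D s t =
      if (s.1.2, s.2) = (t.1.2, t.2) then latticeGreen (s.1.1 - t.1.1) / 2 else 0 := by
  unfold edgeCovKernel edgeGreen
  by_cases h1 : s.2 = t.2 <;> by_cases h2 : s.1.2 = t.1.2 <;> simp [h1, h2]

/-- The `1`-form covariance kernel is positive semidefinite along families (`d ≥ 3`). [folklore] -/
theorem sum_sum_mul_mul_edgeCovKernel_nonneg (hd : 3 ≤ d) (D : ℕ) {J : Type u} [Fintype J]
    (g : J → ZdEdge d × Fin D) (c : J → ℝ) :
    0 ≤ ∑ j, ∑ j', c j * c j' * edgeCovKernel D (g j) (g j') := by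
  simp_rw [edgeCovKernel_eq_ite]
  exact sum_sum_mul_mul_ite_nonneg (fun x y : Literature.Probability.LatticeModels.Site d =>
      latticeGreen (x - y) / 2) (sum_sum_mul_mul_half_latticeGreen_nonneg hd)
    (fun j => (g j).1.1) (fun j => ((g j).1.2, (g j).2)) c

/-- The curvature kernel in terms of the `1`-form kernel: `K = d Γ d*` with colours,
`K((p,a),(q,b)) = ∑_{α,β} σ_α σ_β Γ((∂_α p, a), (∂_β q, b))`. [folklore] -/
theorem curvatureCovKernel_eq_sum (D : ℕ) (s t : ZdPlaquette d × Fin D) :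
    curvatureCovKernel d D s t = ∑ a : Fin 4, ∑ b : Fin 4,
      plaquetteBoundarySign a * plaquetteBoundarySign b *
        edgeCovKernel D (plaquetteBoundary s.1 a, s.2) (plaquetteBoundary t.1 b, t.2) := by
  unfold curvatureCovKernel edgeCovKernel curvatureTwoPoint
  split_ifs <;> simp

/-- `latticeGreen` is even. [folklore] -/
theorem latticeGreen_neg (z : Literature.Probability.LatticeModels.Site d) :
    latticeGreen (-z) = latticeGreen z := by
  simp [latticeGreen, Finset.sum_neg_distrib, mul_neg, Real.cos_neg]

/-- The edge Green kernel is symmetric. [folklore] -/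
theorem edgeGreen_comm (e f : ZdEdge d) : edgeGreen e f = edgeGreen f e := by
  unfold edgeGreen
  by_cases h : e.2 = f.2
  · rw [if_pos h, if_pos h.symm, ← latticeGreen_neg, neg_sub]
  · rw [if_neg h, if_neg (Ne.symm h)]

/-- The two-plaquette kernel is symmetric. [folklore] -/
theorem curvatureTwoPoint_comm (p q : ZdPlaquette d) :
    curvatureTwoPoint p q = curvatureTwoPoint q p := by
  unfold curvatureTwoPoint
  rw [Finset.sum_comm]
  refine Finset.sum_congr rfl fun a _ => Finset.sum_congr rfl fun b _ => ?_
  rw [edgeGreen_comm, mul_comm (plaquetteBoundarySign b)]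

/-- The curvature covariance kernel is symmetric. [folklore] -/
theorem curvatureCovKernel_comm (D : ℕ) (s t : ZdPlaquette d × Fin D) :
    curvatureCovKernel d D s t = curvatureCovKernel d D t s := by
  unfold curvatureCovKernel
  by_cases h : s.2 = t.2
  · rw [if_pos h, if_pos h.symm, curvatureTwoPoint_comm]
  · rw [if_neg h, if_neg (Ne.symm h)]

/-- **The curvature covariance kernel is positive semidefinite for `d ≥ 3`**: every finite Gram
matrix of `K((p,a),(q,b)) = δ_{ab} (d (-Δ)⁻¹ d*)(p,q)` is positive semidefinite, because
`xᵀ K x = ∑ (x_s σ_α)(x_t σ_β) Γ((∂_α p_s, a_s), (∂_β p_t, a_t))` is a quadratic form of the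
positive semidefinite `1`-form kernel `Γ` along the family of boundary edges
(`sum_sum_mul_mul_edgeCovKernel_nonneg`, ultimately the Fourier representation
`∫ w(k) |·|² dk ≥ 0` of the Green function). Hence the finite-dimensional Gaussian laws exist and
are consistent. [folklore] -/
theorem isPosSemidefKernel_curvatureCovKernel (hd : 3 ≤ d) (D : ℕ) :
    IsPosSemidefKernel (curvatureCovKernel d D) := by
  intro I
  refine Matrix.PosSemidef.of_dotProduct_mulVec_nonneg (Matrix.IsHermitian.ext fun s t => ?_)
    fun x => ?_
  · simp only [covGram_apply, star_trivial]
    exact curvatureCovKernel_comm D _ _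
  · rw [star_trivial]
    have expand : x ⬝ᵥ (covGram (curvatureCovKernel d D) I *ᵥ x) =
        ∑ j : I × Fin 4, ∑ j' : I × Fin 4,
          (x j.1 * plaquetteBoundarySign j.2) * (x j'.1 * plaquetteBoundarySign j'.2) *
            edgeCovKernel D
              (plaquetteBoundary (j.1 : ZdPlaquette d × Fin D).1 j.2, (j.1 : ZdPlaquette d × Fin D).2)
              (plaquetteBoundary (j'.1 : ZdPlaquette d × Fin D).1 j'.2,
                (j'.1 : ZdPlaquette d × Fin D).2) := by
      simp only [dotProduct, Matrix.mulVec, covGram_apply, curvatureCovKernel_eq_sum,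
        Fintype.sum_prod_type, Finset.mul_sum, Finset.sum_mul]
      refine Finset.sum_congr rfl fun s _ => ?_
      rw [Finset.sum_comm]
      refine Finset.sum_congr rfl fun a _ => Finset.sum_congr rfl fun t _ =>
        Finset.sum_congr rfl fun b _ => ?_
      ring
    rw [expand]
    exact sum_sum_mul_mul_edgeCovKernel_nonneg hd D _ _

end PosSemidef

/-! ### Lattice symmetries of the Green function and the plaquette variance `2/d` -/

section Variance

open Literature.Probability.LatticeModels Literature.MathematicalPhysics.QuantumLattice Real

variable {d : ℕ}

/-- Invariance of Brillouin-zone integrals under permutations of the coordinates (the cube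
`[-π,π]^d` and Lebesgue measure are permutation invariant; Mathlib
`volume_measurePreserving_piCongrLeft`). [folklore] -/
theorem setIntegral_brillouin_comp_equiv (e : Fin d ≃ Fin d) (f : (Fin d → ℝ) → ℝ) :
    ∫ p in brillouin d, f (fun l => p (e l)) = ∫ p in brillouin d, f p := by
  have hF : ∀ p : Fin d → ℝ,
      (MeasurableEquiv.piCongrLeft (fun _ : Fin d => ℝ) e.symm p : Fin d → ℝ) = fun l => p (e l) := by
    intro p
    funext l
    have h := MeasurableEquiv.piCongrLeft_apply_apply (β := fun _ : Fin d => ℝ) e.symm p (e l)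
    rwa [Equiv.symm_apply_apply] at h
  have hpre : (MeasurableEquiv.piCongrLeft (fun _ : Fin d => ℝ) e.symm) ⁻¹' brillouin d =
      brillouin d := by
    ext p
    simp only [Set.mem_preimage, brillouin, Set.mem_univ_pi, hF]
    exact ⟨fun h l => by simpa using h (e.symm l), fun h l => h (e l)⟩
  have key := (volume_measurePreserving_piCongrLeft (fun _ : Fin d => ℝ) e.symm).setIntegral_preimage_emb
    (MeasurableEquiv.piCongrLeft (fun _ : Fin d => ℝ) e.symm).measurableEmbedding f (brillouin d)
  rw [hpre] at key
  simp_rw [hF] at key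
  exact key

/-- **The lattice Green function is invariant under permutations of the coordinates of `ℤ^d`.**
[folklore] -/
theorem latticeGreen_comp_equiv (e : Fin d ≃ Fin d) (z : Literature.Probability.LatticeModels.Site d) :
    latticeGreen (z ∘ e) = latticeGreen z := by
  unfold latticeGreen
  congr 1
  have hphase : ∀ p : Fin d → ℝ, ∑ i, p i * ((z ∘ e) i : ℝ) = ∑ i, p (e.symm i) * (z i : ℝ) := by
    intro p
    rw [← Equiv.sum_comp e (fun i => p (e.symm i) * (z i : ℝ))]
    simp
  have hdisp : ∀ p : Fin d → ℝ, dispersion (fun l => p (e.symm l)) = dispersion p := fun p => by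
    unfold dispersion
    exact Equiv.sum_comp e.symm (fun l => 1 - Real.cos (p l))
  calc ∫ p in brillouin d, Real.cos (∑ i, p i * ((z ∘ e) i : ℝ)) / dispersion p
      = ∫ p in brillouin d, (fun q : Fin d → ℝ => Real.cos (∑ i, q i * (z i : ℝ)) / dispersion q)
          (fun l => p (e.symm l)) := by
        refine setIntegral_congr_fun (measurableSet_brillouin d) fun p _ => ?_
        simp only [hphase, hdisp]
    _ = ∫ p in brillouin d, Real.cos (∑ i, p i * (z i : ℝ)) / dispersion p :=
        setIntegral_brillouin_comp_equiv e.symm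
          (fun q : Fin d → ℝ => Real.cos (∑ i, q i * (z i : ℝ)) / dispersion q)

/-- `latticeGreen (n eᵢ) = latticeGreen (n eⱼ)`: the Green function takes the same value at all
lattice neighbours of the origin (coordinate permutation symmetry). [folklore] -/
theorem latticeGreen_single (i j : Fin d) (n : ℤ) :
    latticeGreen (Pi.single i n : Literature.Probability.LatticeModels.Site d) =
      latticeGreen (Pi.single j n) := by
  have h := latticeGreen_comp_equiv (Equiv.swap i j) (Pi.single i n)
  have hfun : ((Pi.single i n : Literature.Probability.LatticeModels.Site d) ∘ (Equiv.swap i j)) =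
      Pi.single j n := by
    funext l
    simp only [Function.comp_apply, Pi.single_apply, Equiv.swap_apply_eq_iff,
      Equiv.swap_apply_left]
  rw [hfun] at h
  exact h.symm

/-- **The nearest-neighbour increment of the Green function**: `G₀(0) - G₀(e₁) = 1/(2d)` for
`G₀ = latticeGreen/2`, i.e. `latticeGreen 0 - latticeGreen e₁ = 1/d` (`d ≥ 3`), from
`(-Δ) G₀ (0) = 1` (tree `latticeLaplacianZd_half_latticeGreen`) and the symmetries
`G₀(±eᵢ) = G₀(e₁)`. In random-walk terms: the escape probability identity at the origin.
[folklore] -/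
theorem latticeGreen_zero_sub_latticeGreen_single (hd : 3 ≤ d) (i : Fin d) :
    latticeGreen (0 : Literature.Probability.LatticeModels.Site d) - latticeGreen (Pi.single i 1) =
      1 / d := by
  have hP := latticeLaplacianZd_half_latticeGreen d hd 0
  rw [if_pos rfl, latticeLaplacianZd] at hP
  have hterm : ∀ l : Fin d,
      latticeGreen ((0 : Literature.Probability.LatticeModels.Site d) + Pi.single l 1) / 2 +
        latticeGreen ((0 : Literature.Probability.LatticeModels.Site d) - Pi.single l 1) / 2 =
      latticeGreen (Pi.single i 1 : Literature.Probability.LatticeModels.Site d) := by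
    intro l
    rw [zero_add, zero_sub, latticeGreen_neg, latticeGreen_single l i]
    ring
  simp only [hterm, Finset.sum_const, Finset.card_univ, Fintype.card_fin, nsmul_eq_mul] at hP
  have hd0 : (d : ℝ) ≠ 0 := by positivity
  field_simp
  linarith

/-- **The plaquette variance of the lattice Maxwell field strength is `2/d`** (`d ≥ 3`):
`curvatureTwoPoint p p = 4 G₀(0) - ∑_{±} (G₀(±eᵢ) + G₀(±eⱼ)) = 4 (G₀(0) - G₀(e₁)) = 2/d`.
Equivalently (equipartition): the `d(d-1)/2` plaquettes per site carry total mean energy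
`½ ∑_p E[F_p²] = (d-1)/2` per site, one half per non-gauge degree of freedom. This is the
`c_0 = 2/d` of the requesting route. [folklore] -/
theorem curvatureTwoPoint_self (hd : 3 ≤ d) (p : ZdPlaquette d) : curvatureTwoPoint p p = 2 / d := by
  obtain ⟨x, ⟨i, j⟩, hij⟩ := p
  have hne : i ≠ j := ne_of_lt hij
  have h1 := latticeGreen_zero_sub_latticeGreen_single hd i
  have hi : latticeGreen (Pi.single i 1 : Literature.Probability.LatticeModels.Site d) =
      latticeGreen (Pi.single j 1) := latticeGreen_single i j 1
  simp only [curvatureTwoPoint, Fin.sum_univ_four, plaquetteBoundary, plaquetteBoundarySign,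
    edgeGreen, Matrix.cons_val_zero, Matrix.cons_val_one, Matrix.cons_val, hne, hne.symm,
    ↓reduceIte, sub_self, add_sub_cancel_left, sub_add_cancel_left, latticeGreen_neg]
  rw [hi] at h1 ⊢
  linear_combination (2 : ℝ) * h1

/-- **`c_0 = 2/d`**: the plaquette two-point numbers along the axis start at the variance `2/d`.
[folklore] -/
theorem curvaturePlaquetteCorr_zero (hd : 3 ≤ d) : curvaturePlaquetteCorr hd 0 = 2 / d := by
  rw [curvaturePlaquetteCorr, Pi.single_zero]
  exact curvatureTwoPoint_self hd _

end Variance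

/-! ### The law of the curvature Gaussian field: probability, centred, Gaussian, covariance -/

section FieldAPI

open Literature.Probability.LatticeModels Literature.MathematicalPhysics.QuantumLattice

variable {d : ℕ}

/-- The curvature Gaussian field is a probability measure (`d ≥ 3`). [folklore] -/
theorem isProbabilityMeasure_curvatureGaussianField (hd : 3 ≤ d) (D : ℕ) :
    IsProbabilityMeasure (curvatureGaussianField d D) := by
  haveI := isProbabilityMeasure_gaussianFieldOfKernel (isPosSemidefKernel_curvatureCovKernel hd D)
  exact Measure.isProbabilityMeasure_map (MeasurableEquiv.measurable _).aemeasurable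

/-- The curvature Gaussian field is centred: `E[Y_p^a] = 0` (`d ≥ 3`). [folklore] -/
theorem integral_eval_curvatureGaussianField (hd : 3 ≤ d) (D : ℕ) (p : ZdPlaquette d) (a : Fin D) :
    ∫ ω, ω p a ∂curvatureGaussianField d D = 0 := by
  rw [curvatureGaussianField, integral_map_equiv]
  exact integral_eval_gaussianFieldOfKernel (isPosSemidefKernel_curvatureCovKernel hd D) (p, a)

/-- **The covariance of the curvature Gaussian field** (`d ≥ 3`):
`E[Y_p^a Y_q^b] = Cov(Y_p^a, Y_q^b) = δ_{ab} · (d (-Δ)⁻¹ d*)(p, q) = δ_{ab} · curvatureTwoPoint p q`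
— `D` independent copies of the gradient spin-wave covariance (Garban–Sepúlveda 2023 §4,
Proposition, "centred Gaussian process with variance `⟨f, d d* Δ⁻¹ f⟩`"). [folklore] -/
theorem covariance_eval_curvatureGaussianField (hd : 3 ≤ d) (D : ℕ) (p q : ZdPlaquette d)
    (a b : Fin D) :
    cov[fun ω => ω p a, fun ω => ω q b; curvatureGaussianField d D] =
      if a = b then curvatureTwoPoint p q else 0 := by
  rw [curvatureGaussianField, covariance_map_equiv]
  exact covariance_eval_gaussianFieldOfKernel (isPosSemidefKernel_curvatureCovKernel hd D) (p, a) (q, b)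

/-- Different colour components are uncorrelated (hence, being jointly Gaussian, independent).
[folklore] -/
theorem covariance_eval_curvatureGaussianField_of_ne (hd : 3 ≤ d) (D : ℕ) (p q : ZdPlaquette d)
    {a b : Fin D} (hab : a ≠ b) :
    cov[fun ω => ω p a, fun ω => ω q b; curvatureGaussianField d D] = 0 := by
  rw [covariance_eval_curvatureGaussianField hd, if_neg hab]

/-- **The plaquette variance `E[(Y_p^a)²] = 2/d`** of the curvature Gaussian field (`d ≥ 3`).
[folklore] -/
theorem variance_eval_curvatureGaussianField (hd : 3 ≤ d) (D : ℕ) (p : ZdPlaquette d) (a : Fin D) :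
    Var[fun ω => ω p a; curvatureGaussianField d D] = 2 / d := by
  have hm : Measurable fun ω : ZdPlaquette d → Fin D → ℝ => ω p a :=
    (measurable_pi_apply a).comp (measurable_pi_apply p)
  rw [← covariance_self hm.aemeasurable, covariance_eval_curvatureGaussianField hd, if_pos rfl,
    curvatureTwoPoint_self hd]

/-- The two-point numbers along the axis are covariances of the field:
`c_n = Cov(Y¹_{(0;1,2)}, Y¹_{(n e₀;1,2)})` (`d ≥ 3`, `D ≥ 1`). [folklore] -/
theorem covariance_plaquette12_curvatureGaussianField (hd : 3 ≤ d) {D : ℕ} (a : Fin D) (n : ℤ) :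
    cov[fun ω => ω (plaquette12 hd 0) a, fun ω => ω (plaquette12 hd (Pi.single ⟨0, by omega⟩ n)) a;
      curvatureGaussianField d D] = curvaturePlaquetteCorr hd n := by
  rw [covariance_eval_curvatureGaussianField hd, if_pos rfl, curvaturePlaquetteCorr]

/-- **The coordinate process `(p, a) ↦ Y_p^a` is a (centred) Gaussian process** under the
curvature Gaussian field (`d ≥ 3`): all finite-dimensional laws are Gaussian. [folklore] -/
theorem isGaussianProcess_eval_curvatureGaussianField (hd : 3 ≤ d) (D : ℕ) :
    IsGaussianProcess (fun (s : ZdPlaquette d × Fin D) (ω : ZdPlaquette d → Fin D → ℝ) => ω s.1 s.2)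
      (curvatureGaussianField d D) := by
  have h := isGaussianProcess_eval_gaussianFieldOfKernel (isPosSemidefKernel_curvatureCovKernel hd D)
  refine ⟨fun I => ⟨?_⟩⟩
  have hI := (h.hasGaussianLaw I).isGaussian_map
  have hmeas : Measurable fun ω : ZdPlaquette d → Fin D → ℝ =>
      I.restrict fun s : ZdPlaquette d × Fin D => ω s.1 s.2 :=
    measurable_pi_lambda _ fun s => (measurable_pi_apply _).comp (measurable_pi_apply _)
  rw [curvatureGaussianField, Measure.map_map hmeas (MeasurableEquiv.measurable _)]
  exact hI

/-- **Uniqueness of the curvature Gaussian field** (`d ≥ 3`): a probability measure on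
`ℝ^D`-valued `2`-cochains under which the plaquette variables `(Y_p^a)` form a Gaussian process
with mean zero and covariance `δ_{ab} (d (-Δ)⁻¹ d*)(p, q)` *is* `curvatureGaussianField d D` — the
form in which a limit law is identified in the intended application (Kallenberg Lemma 13.1: a
Gaussian law is determined by its mean and covariance functions). [cite: Kallenberg2002, Lemma 13.1] -/
theorem eq_curvatureGaussianField_of_isGaussianProcess (hd : 3 ≤ d) (D : ℕ)
    {ν : Measure (ZdPlaquette d → Fin D → ℝ)} [IsProbabilityMeasure ν]
    (hG : IsGaussianProcess
      (fun (s : ZdPlaquette d × Fin D) (ω : ZdPlaquette d → Fin D → ℝ) => ω s.1 s.2) ν)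
    (hm : ∀ (p : ZdPlaquette d) (a : Fin D), ∫ ω, ω p a ∂ν = 0)
    (hc : ∀ (p q : ZdPlaquette d) (a b : Fin D),
      cov[fun ω => ω p a, fun ω => ω q b; ν] = if a = b then curvatureTwoPoint p q else 0) :
    ν = curvatureGaussianField d D := by
  have hK := isPosSemidefKernel_curvatureCovKernel hd D
  haveI : IsProbabilityMeasure (ν.map (MeasurableEquiv.curry (ZdPlaquette d) (Fin D) ℝ).symm) :=
    Measure.isProbabilityMeasure_map (MeasurableEquiv.measurable _).aemeasurable
  have hres : ∀ I : Finset (ZdPlaquette d × Fin D),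
      Measurable fun ω : ZdPlaquette d × Fin D → ℝ => I.restrict fun s => ω s :=
    fun I => measurable_pi_lambda _ fun s => measurable_pi_apply _
  have h' : ν.map (MeasurableEquiv.curry (ZdPlaquette d) (Fin D) ℝ).symm =
      gaussianFieldOfKernel (curvatureCovKernel d D) := by
    refine eq_gaussianFieldOfKernel_of_isGaussianProcess hK ?_ (fun s => ?_) (fun s t => ?_)
    · refine ⟨fun I => ⟨?_⟩⟩
      rw [Measure.map_map (hres I) (MeasurableEquiv.measurable _)]
      exact (hG.hasGaussianLaw I).isGaussian_map
    · rw [integral_map_equiv]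
      exact hm s.1 s.2
    · rw [covariance_map_equiv]
      exact hc s.1 t.1 s.2 t.2
  calc ν = (ν.map (MeasurableEquiv.curry (ZdPlaquette d) (Fin D) ℝ).symm).map
        (MeasurableEquiv.curry (ZdPlaquette d) (Fin D) ℝ) := (MeasurableEquiv.map_map_symm _).symm
    _ = curvatureGaussianField d D := by rw [h']; rfl

end FieldAPI




end Literature.MathematicalPhysics.QuantumFieldTheory
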